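import Literature.Probability.Percolation.ClusterEdgeRegionSplicing
import HarnessLib

/-!
# The non-hub half of the two-link deficit row `W0` on EVERY finite graph: the three-region swap map `T0`

Support file for crux `stmt-CriticalPhenomena-4575` (`NoHeavyLowerTail`), seat `prim-l12-p1` gen 13
(`--supports stmt-CriticalPhenomena-4575`).  Memos `run/shared/lean/prim/prim-l12/FROM-prim-l12-p1-g12-W0-TWO-LINK-DEFICIT.md`
(§3, the tree `T0`) and `FROM-prim-l12-p1-g13-HUB-PROBLEM.md` (§1, the injective-map form proved here).

Setting: two independent bond configurations `C₁, C₂ ⊆ D` on a finite edge set `D ⊆ Sym2 V` with arbitrary edge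
probabilities `p_e ∈ [0,1]` (finitary calculus `DecisionTree.Pr2W` of `DecisionTreeWeighted.lean`), four vertices
`a b c y`.  The row `W0` of gen 12 (`P(ab|c|y)·P(a|b|cy) ≤ P(ab|cy)·[P(∅)+P(ab|c|y)] + P(∅)·[P(a|bcy)+P(acy|b)]`,
kernel-checked for `≤ 5` vertices in `…TwoLinkDeficitLeFive`) splits, at the level of pairs `(C₁, C₂)`, into a
NON-HUB part (`a` is joined to `b` by `C₁`-open edges avoiding the `C₂`-cluster `D_c` of `c`) and a HUB part.  THIS
FILE settles the non-hub part for every finite graph: the map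

  `T0 (C₁, C₂) = (C₂ on F, C₁ off F ;  C₁ on F, C₂ off F)`,   `F = Ē(cl_{C₁} c) ∪ Ē(cl_{C₁} y) ∪ Ē(cl_{C₂} c)`

(`Ē(W)` = edges of `D` meeting `W`; Gladkov–Zimin cluster switching, arXiv:2404.08873 Lemma 4.2 / Gladkov
arXiv:2408.08457 Lemma 3.1, here with a region read from BOTH configurations) is a weight-preserving INJECTION of
the pair space (`t0Map_injective`, explicit inverse `t0Inv`, because the three clusters can be read off the image:
`clus_t0Map_fst_c`, `clus_t0Map_snd_c`, `clus_t0Map_snd_y`), hence preserves `Pr2W` (`Pr2W_preimage_t0Map`); and it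
maps the non-hub event into the target cells `(ab|cy ; c and y isolated)` (`t0Map_mem_target`).  Consequently
(`Pr2W_nonHub_le`): for every finite weighted graph,

  `P⊗P{ c,y ∉ cl₁(a,b)-side conditions, y ∈ cl₂(c), a ~ b in C₁ off V(cl₂ c) }  ≤  P⊗P{ C₃ ∈ ab|cy, c and y singletons in C₄ }`,

i.e. the non-hub part of `P(ab|c|y)P(a|b|cy)` is at most `P(ab|cy)·[P(∅) + P(ab|c|y)]`.  The complementary HUB part
(`V(cl₂ c)` separates `a` from `b` in `C₁`) is what remains of `W0` for all `n` (memo gen 13, "hub lemma"; exhaustive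
tree evidence there).  All statements here are for ALL finite graphs; no computation.
-/

noncomputable section

open Classical

namespace Summit.CriticalPhenomena.PercolationContinuityZ3.Theorems.W0NonHubSwap

open Finset
open Literature.Probability.Percolation
open Literature.Probability.Percolation.DecisionTree
open Literature.Probability.Percolation.ClusterRegion

variable {V : Type*} [Fintype V] [DecidableEq V]

/-! ## The swap region and the map -/

/-- The swap region of `T0`: the edge regions of the `C₁`-clusters of `c` and `y` and of the `C₂`-cluster of `c`,
`F(C₁,C₂) = Ē(cl_{C₁} c) ∪ Ē(cl_{C₁} y) ∪ Ē(cl_{C₂} c)`. [this work] -/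
def region (D : Finset (Sym2 V)) (c y : V) (x : Finset (Sym2 V) × Finset (Sym2 V)) : Finset (Sym2 V) :=
  edgeReg D (clus D x.1 c) ∪ edgeReg D (clus D x.1 y) ∪ edgeReg D (clus D x.2 c)

/-- The map `T0`: exchange the two configurations on the region `F(C₁, C₂)`:
`(C₁, C₂) ↦ (C₂ on F ∪ C₁ off F, C₁ on F ∪ C₂ off F)`. [this work] -/
def t0Map (D : Finset (Sym2 V)) (c y : V) (x : Finset (Sym2 V) × Finset (Sym2 V)) :
    Finset (Sym2 V) × Finset (Sym2 V) :=
  (splice (region D c y x) x.2 x.1, splice (region D c y x) x.1 x.2)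

/-- The region read off an IMAGE pair `(C₃, C₄)`: the `C₄`-clusters of `c`, `y` and the `C₃`-cluster of `c`
(`= region (C₄, C₃)`). [this work] -/
def regionInv (D : Finset (Sym2 V)) (c y : V) (z : Finset (Sym2 V) × Finset (Sym2 V)) : Finset (Sym2 V) :=
  region D c y (z.2, z.1)

/-- The inverse map: exchange back on the region read off the image. [this work] -/
def t0Inv (D : Finset (Sym2 V)) (c y : V) (z : Finset (Sym2 V) × Finset (Sym2 V)) :
    Finset (Sym2 V) × Finset (Sym2 V) :=
  (splice (regionInv D c y z) z.2 z.1, splice (regionInv D c y z) z.1 z.2)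

variable {D : Finset (Sym2 V)} {c y : V}

/-- `Ē(cl_{C₁} c) ⊆ F`. [this work] -/
theorem edgeReg_fst_c_subset (x : Finset (Sym2 V) × Finset (Sym2 V)) :
    edgeReg D (clus D x.1 c) ⊆ region D c y x := fun _ he =>
  mem_union.2 (Or.inl (mem_union.2 (Or.inl he)))

/-- `Ē(cl_{C₁} y) ⊆ F`. [this work] -/
theorem edgeReg_fst_y_subset (x : Finset (Sym2 V) × Finset (Sym2 V)) :
    edgeReg D (clus D x.1 y) ⊆ region D c y x := fun _ he =>
  mem_union.2 (Or.inl (mem_union.2 (Or.inr he)))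

/-- `Ē(cl_{C₂} c) ⊆ F`. [this work] -/
theorem edgeReg_snd_c_subset (x : Finset (Sym2 V) × Finset (Sym2 V)) :
    edgeReg D (clus D x.2 c) ⊆ region D c y x := fun _ he => mem_union.2 (Or.inr he)

/-- The first image configuration has the `C₂`-cluster of `c`: `cl_{C₃} c = cl_{C₂} c` (it agrees with `C₂` on
the edge region of that cluster). [this work] -/
theorem clus_t0Map_fst_c (x : Finset (Sym2 V) × Finset (Sym2 V)) :
    clus D (t0Map D c y x).1 c = clus D x.2 c :=
  clus_eq_of_agree fun _ he => (mem_splice_of_mem (edgeReg_snd_c_subset x he)).symm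

/-- The second image configuration has the `C₁`-cluster of `c`: `cl_{C₄} c = cl_{C₁} c`. [this work] -/
theorem clus_t0Map_snd_c (x : Finset (Sym2 V) × Finset (Sym2 V)) :
    clus D (t0Map D c y x).2 c = clus D x.1 c :=
  clus_eq_of_agree fun _ he => (mem_splice_of_mem (edgeReg_fst_c_subset x he)).symm

/-- The second image configuration has the `C₁`-cluster of `y`: `cl_{C₄} y = cl_{C₁} y`. [this work] -/
theorem clus_t0Map_snd_y (x : Finset (Sym2 V) × Finset (Sym2 V)) :
    clus D (t0Map D c y x).2 y = clus D x.1 y :=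
  clus_eq_of_agree fun _ he => (mem_splice_of_mem (edgeReg_fst_y_subset x he)).symm

/-- The region can be read off the image: `regionInv (T0 x) = region x`. [this work] -/
theorem regionInv_t0Map (x : Finset (Sym2 V) × Finset (Sym2 V)) :
    regionInv D c y (t0Map D c y x) = region D c y x := by
  unfold regionInv region
  simp only [clus_t0Map_fst_c, clus_t0Map_snd_c, clus_t0Map_snd_y]

/-- `t0Inv` is a left inverse of `t0Map`; in particular `T0` is injective on all pairs. [this work] -/
theorem t0Inv_t0Map (x : Finset (Sym2 V) × Finset (Sym2 V)) : t0Inv D c y (t0Map D c y x) = x := by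
  unfold t0Inv
  rw [regionInv_t0Map]
  unfold t0Map
  simp only [splice_splice_left]

/-- `T0` is injective. [this work] -/
theorem t0Map_injective : Function.Injective (t0Map D c y) :=
  Function.LeftInverse.injective (g := t0Inv D c y) t0Inv_t0Map

/-- `T0` preserves the pair weight (edgewise it only exchanges the two bits).
[cite: Gladkov2024, Lemma 3.1 (= GZ24 Lemma 4.2)] -/
theorem wt2W_t0Map (p : Sym2 V → ℝ) (x : Finset (Sym2 V) × Finset (Sym2 V)) :
    wt2W D p (t0Map D c y x) = wt2W D p x := by
  unfold wt2W t0Map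
  simp only
  rw [wtW_splice_mul_wtW_splice, mul_comm]

/-- `T0` maps pairs of configurations `⊆ D` to pairs `⊆ D`. [this work] -/
theorem t0Map_mem_pairs {x : Finset (Sym2 V) × Finset (Sym2 V)} (hx : x ∈ D.powerset ×ˢ D.powerset) :
    t0Map D c y x ∈ D.powerset ×ˢ D.powerset := by
  rw [mem_product, mem_powerset, mem_powerset] at hx ⊢
  exact ⟨splice_subset hx.2 hx.1, splice_subset hx.1 hx.2⟩

/-! ## Counting form: an injective weight-preserving self-map of the pair space preserves `Pr2W` -/

/-- **Counting form of the switching lemma for pairs**: an injective self-map of the pairs inside `D` preserving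
every pair weight is a weight-preserving bijection, so `Σ_x wt2W x · f (Φ x) = Σ_x wt2W x · f x`.
[cite: Gladkov2024, Lemma 3.1 (proof idea: a measure-preserving bijection); cf. `DecisionTree.sum_wt3W_comp_eq_of_injOn`] -/
theorem sum_wt2W_comp_eq_of_injOn {ι : Type*} [DecidableEq ι] (E : Finset ι) (p : ι → ℝ)
    {Φ : Finset ι × Finset ι → Finset ι × Finset ι} (hw : ∀ x, wt2W E p (Φ x) = wt2W E p x)
    (hmaps : ∀ x ∈ E.powerset ×ˢ E.powerset, Φ x ∈ E.powerset ×ˢ E.powerset)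
    (hinj : Set.InjOn Φ ↑(E.powerset ×ˢ E.powerset)) (f : Finset ι × Finset ι → ℝ) :
    ∑ x ∈ E.powerset ×ˢ E.powerset, wt2W E p x * f (Φ x) = ∑ x ∈ E.powerset ×ˢ E.powerset, wt2W E p x * f x := by
  have hmaps' : Set.MapsTo Φ ↑(E.powerset ×ˢ E.powerset) ↑(E.powerset ×ˢ E.powerset) := fun x hx => hmaps x hx
  have hsurj : Set.SurjOn Φ ↑(E.powerset ×ˢ E.powerset) ↑(E.powerset ×ˢ E.powerset) :=
    Finset.surjOn_of_injOn_of_card_le Φ hmaps' hinj le_rfl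
  calc ∑ x ∈ E.powerset ×ˢ E.powerset, wt2W E p x * f (Φ x)
      = ∑ x ∈ E.powerset ×ˢ E.powerset, wt2W E p (Φ x) * f (Φ x) :=
        sum_congr rfl fun x _ => by rw [hw]
    _ = ∑ z ∈ E.powerset ×ˢ E.powerset, wt2W E p z * f z :=
        Finset.sum_nbij Φ hmaps hinj hsurj fun x _ => rfl

/-- `Pr2W` is invariant under `T0`: `P⊗P{x : T0 x ∈ Y} = P⊗P(Y)`. [this work] -/
theorem Pr2W_preimage_t0Map (p : Sym2 V → ℝ) (Y : Set (Finset (Sym2 V) × Finset (Sym2 V))) :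
    Pr2W D p {x | t0Map D c y x ∈ Y} = Pr2W D p Y := by
  rw [Pr2W_eq_sum_ind, Pr2W_eq_sum_ind]
  have h := sum_wt2W_comp_eq_of_injOn D p (Φ := t0Map D c y) (wt2W_t0Map p)
    (fun x hx => t0Map_mem_pairs hx) (fun x _ x' _ hxx' => t0Map_injective hxx') (ind Y)
  refine Eq.trans (sum_congr rfl fun x _ => ?_) h
  by_cases hx : t0Map D c y x ∈ Y
  · rw [ind_of_mem hx, ind_of_mem (show x ∈ {x | t0Map D c y x ∈ Y} from hx)]
  · rw [ind_of_not_mem hx, ind_of_not_mem (show x ∉ {x | t0Map D c y x ∈ Y} from hx)]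

/-! ## The events and the image property -/

/-- The NON-HUB source event (a superset of the non-hub part of `{C₁ ∈ ab|c|y} × {C₂ ∈ a|b|cy}`): in `C₁` the clusters
of `c` and of `y` avoid `a, b` (and `y ∉ cl₁ c`); in `C₂`, `y ∈ cl₂ c ∌ a, b`; and `a` is joined to `b` by `C₁`-open edges
of `D` not meeting the `C₂`-cluster of `c`. [this work] -/
def nonHubEvent (D : Finset (Sym2 V)) (a b c y : V) : Set (Finset (Sym2 V) × Finset (Sym2 V)) :=
  {x | a ∉ clus D x.1 c ∧ b ∉ clus D x.1 c ∧ y ∉ clus D x.1 c ∧ a ∉ clus D x.1 y ∧ b ∉ clus D x.1 y ∧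
      y ∈ clus D x.2 c ∧ a ∉ clus D x.2 c ∧ b ∉ clus D x.2 c ∧
      (openGraph (↑(avoid D x.1 (clus D x.2 c)) : Set (Sym2 V))).Reachable a b}

/-- The target event (the cells `(ab|cy ; ⊥)` and `(ab|cy ; ab|c|y)` of the row, as cluster conditions): in the first
configuration `y ∈ cl c ∌ a, b` and `b ∈ cl a`; in the second, the clusters of `c` and `y` contain no other marked vertex.
[this work] -/
def targetEvent (D : Finset (Sym2 V)) (a b c y : V) : Set (Finset (Sym2 V) × Finset (Sym2 V)) :=
  {z | y ∈ clus D z.1 c ∧ a ∉ clus D z.1 c ∧ b ∉ clus D z.1 c ∧ b ∈ clus D z.1 a ∧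
      a ∉ clus D z.2 c ∧ b ∉ clus D z.2 c ∧ y ∉ clus D z.2 c ∧ a ∉ clus D z.2 y ∧ b ∉ clus D z.2 y}

variable {a b : V}

/-- A vertex `C₁`-joined to `a` is not in a `C₁`-cluster that misses `a`. [this work] -/
theorem not_mem_clus_of_mem_clus {K : Finset (Sym2 V)} {u v : V} (hu : u ∈ clus D K a) (ha : a ∉ clus D K v) :
    u ∉ clus D K v := by
  intro huv
  have h1 : clus D K u = clus D K v := clus_eq_clus_of_mem huv
  have h2 : clus D K u = clus D K a := clus_eq_clus_of_mem hu
  exact ha (h1 ▸ h2 ▸ mem_clus_self (D := D) (K := K) a)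

/-- **The image property**: `T0` maps the non-hub event into the target cells. [this work] -/
theorem t0Map_mem_target {x : Finset (Sym2 V) × Finset (Sym2 V)} (hx : x ∈ nonHubEvent D a b c y) :
    t0Map D c y x ∈ targetEvent D a b c y := by
  obtain ⟨ha1c, hb1c, hy1c, ha1y, hb1y, hy2c, ha2c, hb2c, hreach⟩ := hx
  refine ⟨?_, ?_, ?_, ?_, ?_, ?_, ?_, ?_, ?_⟩
  · rw [clus_t0Map_fst_c]; exact hy2c
  · rw [clus_t0Map_fst_c]; exact ha2c
  · rw [clus_t0Map_fst_c]; exact hb2c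
  · -- transfer the `C₁`-path avoiding `V(cl₂ c)`: its edges lie off the region, where `C₃ = C₁`
    have key := reach_transfer' (M := avoid D x.1 (clus D x.2 c)) (M' := (t0Map D c y x).1 ∩ D)
      (fun v => v ∈ clus D x.1 a) ?_ hreach (mem_clus_self a)
    · exact mem_clus.2 key.2
    · intro u v hu he huv
      obtain ⟨⟨he1, heD⟩, havoid⟩ := mem_avoid.1 he
      have hv : v ∈ clus D x.1 a := mem_clus_of_adj hu (mem_inter.2 ⟨he1, heD⟩) huv
      refine ⟨hv, mem_inter.2 ⟨?_, heD⟩⟩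
      have hnotF : s(u, v) ∉ region D c y x := by
        intro hF
        rcases mem_union.1 hF with hF | hF
        · rcases mem_union.1 hF with hF | hF
          · obtain ⟨-, w, hw, hwe⟩ := mem_edgeReg.1 hF
            rcases Sym2.mem_iff.1 hwe with rfl | rfl
            · exact not_mem_clus_of_mem_clus hu ha1c hw
            · exact not_mem_clus_of_mem_clus hv ha1c hw
          · obtain ⟨-, w, hw, hwe⟩ := mem_edgeReg.1 hF
            rcases Sym2.mem_iff.1 hwe with rfl | rfl
            · exact not_mem_clus_of_mem_clus hu ha1y hw
            · exact not_mem_clus_of_mem_clus hv ha1y hw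
        · obtain ⟨-, w, hw, hwe⟩ := mem_edgeReg.1 hF
          exact havoid w hw hwe
      show s(u, v) ∈ splice (region D c y x) x.2 x.1
      exact (mem_splice_of_not_mem hnotF).2 he1
  · rw [clus_t0Map_snd_c]; exact ha1c
  · rw [clus_t0Map_snd_c]; exact hb1c
  · rw [clus_t0Map_snd_c]; exact hy1c
  · rw [clus_t0Map_snd_y]; exact ha1y
  · rw [clus_t0Map_snd_y]; exact hb1y

/-! ## The inequality -/

/-- **Non-hub half of `W0`, every finite graph**: for edge probabilities in `[0,1]`,
`P⊗P(nonHubEvent) ≤ P⊗P(targetEvent)` — the part of `P(ab|c|y)·P(a|b|cy)` where `a ~ b` in `C₁` off the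
`C₂`-cluster of `c` is at most `P(ab|cy)·[P(∅) + P(ab|c|y)]`. [this work] -/
theorem Pr2W_nonHub_le {p : Sym2 V → ℝ} (hp0 : ∀ e, 0 ≤ p e) (hp1 : ∀ e, p e ≤ 1) (a b c y : V) :
    Pr2W D p (nonHubEvent D a b c y) ≤ Pr2W D p (targetEvent D a b c y) := by
  have hsub : ∀ x : Finset (Sym2 V) × Finset (Sym2 V), x.1 ⊆ D → x.2 ⊆ D →
      x ∈ nonHubEvent D a b c y → x ∈ {x | t0Map D c y x ∈ targetEvent D a b c y} := by
    intro x _ _ hx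
    rw [Set.mem_setOf_eq]
    exact t0Map_mem_target hx
  have h1 : Pr2W D p (nonHubEvent D a b c y) ≤ Pr2W D p {x | t0Map D c y x ∈ targetEvent D a b c y} :=
    Pr2W_mono D hp0 hp1 hsub
  have h2 : Pr2W D p {x | t0Map D c y x ∈ targetEvent D a b c y} = Pr2W D p (targetEvent D a b c y) :=
    Pr2W_preimage_t0Map p (targetEvent D a b c y)
  exact h1.trans_eq h2

/-! ## The residual cells `RA⁺` are never hit by `T0` on pairs with `a ≁ b` in `C₂` -/

/-- The residual `(ab|cy ; ab|c|y)`-type cells `RA⁺` reserved for hub pairs: the SECOND component has an `a–b`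
path of open edges of `D` avoiding the vertices of `cl₁ c`, `cl₂ c`, `cl₂ y` of the pair (`cl₁` = first component,
`cl₂` = second).  [this work] -/
def residualPlus (D : Finset (Sym2 V)) (a b c y : V) : Set (Finset (Sym2 V) × Finset (Sym2 V)) :=
  {z | (openGraph (↑(avoid D z.2 (clus D z.1 c ∪ clus D z.2 c ∪ clus D z.2 y)) : Set (Sym2 V))).Reachable a b}

/-- **`T0` never lands in `RA⁺`** as long as `a` and `b` are not joined in `C₂` (true on all of
`{C₁ ∈ ab|c|y} × {C₂ ∈ a|b|cy}`): an `a–b` path in the image's second component avoiding the three clusters lies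
off the region, where that component equals `C₂`.  Hence the images of `T0` (non-hub pairs) and of any map of the
hub pairs into the `K`-cells `∪ RA⁺` are disjoint. [this work] -/
theorem t0Map_not_mem_residualPlus {x : Finset (Sym2 V) × Finset (Sym2 V)} (hab : b ∉ clus D x.2 a) :
    t0Map D c y x ∉ residualPlus D a b c y := by
  intro h
  have hreach : (openGraph (↑(avoid D (t0Map D c y x).2
      (clus D (t0Map D c y x).1 c ∪ clus D (t0Map D c y x).2 c ∪ clus D (t0Map D c y x).2 y)) : Set (Sym2 V))).Reachable a b := h
  rw [clus_t0Map_fst_c, clus_t0Map_snd_c, clus_t0Map_snd_y] at hreach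
  have key := reach_transfer' (M := avoid D (t0Map D c y x).2 (clus D x.2 c ∪ clus D x.1 c ∪ clus D x.1 y))
    (M' := x.2 ∩ D) (fun _ => True) ?_ hreach trivial
  · exact hab (mem_clus.2 key.2)
  · intro u v _ he _
    obtain ⟨⟨he2, heD⟩, havoid⟩ := mem_avoid.1 he
    refine ⟨trivial, mem_inter.2 ⟨?_, heD⟩⟩
    have hnotF : s(u, v) ∉ region D c y x := by
      intro hF
      rcases mem_union.1 hF with hF | hF
      · rcases mem_union.1 hF with hF | hF
        · obtain ⟨-, w, hw, hwe⟩ := mem_edgeReg.1 hF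
          exact havoid w (mem_union.2 (Or.inl (mem_union.2 (Or.inr hw)))) hwe
        · obtain ⟨-, w, hw, hwe⟩ := mem_edgeReg.1 hF
          exact havoid w (mem_union.2 (Or.inr hw)) hwe
      · obtain ⟨-, w, hw, hwe⟩ := mem_edgeReg.1 hF
        exact havoid w (mem_union.2 (Or.inl (mem_union.2 (Or.inl hw)))) hwe
    have : s(u, v) ∈ splice (region D c y x) x.1 x.2 := he2
    exact (mem_splice_of_not_mem hnotF).1 this

/-! ## The target cells factor: `P⊗P(targetEvent) = P(C₃ ∈ ab|cy) · P(c, y singletons in C₄)` -/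

/-- First-coordinate part of the target: `y ∈ cl c ∌ a, b` and `b ∈ cl a` (the cell `ab|cy`). [this work] -/
def targetFst (D : Finset (Sym2 V)) (a b c y : V) : Set (Finset (Sym2 V)) :=
  {S | y ∈ clus D S c ∧ a ∉ clus D S c ∧ b ∉ clus D S c ∧ b ∈ clus D S a}

/-- Second-coordinate part of the target: the clusters of `c` and of `y` contain no other marked vertex
(the cells `⊥` and `ab|c|y` together). [this work] -/
def targetSnd (D : Finset (Sym2 V)) (a b c y : V) : Set (Finset (Sym2 V)) :=
  {S | a ∉ clus D S c ∧ b ∉ clus D S c ∧ y ∉ clus D S c ∧ a ∉ clus D S y ∧ b ∉ clus D S y}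

/-- The target event is the product of its two coordinate parts. [this work] -/
theorem targetEvent_eq_prod (D : Finset (Sym2 V)) (a b c y : V) :
    targetEvent D a b c y = targetFst D a b c y ×ˢ targetSnd D a b c y := by
  ext z
  simp only [targetEvent, targetFst, targetSnd, Set.mem_setOf_eq, Set.mem_prod]
  tauto

/-- **Factorisation of the bound**: `P⊗P(targetEvent) = PrW(targetFst) · PrW(targetSnd)`, i.e. the right side of
`Pr2W_nonHub_le` is `P(C₃ ∈ ab|cy) · [P(C₄ ∈ ⊥) + P(C₄ ∈ ab|c|y)] = P11 · (q + Sab)` in the cell notation of the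
row `W0`. [this work] -/
theorem Pr2W_targetEvent_eq_mul (p : Sym2 V → ℝ) (a b c y : V) :
    Pr2W D p (targetEvent D a b c y) = PrW D p (targetFst D a b c y) * PrW D p (targetSnd D a b c y) := by
  rw [targetEvent_eq_prod, Pr2W_prod]

/-- `Pr2W_nonHub_le` in factored form: the non-hub part of `P(ab|c|y)·P(a|b|cy)` is at most
`P(C ∈ ab|cy) · P(c and y are singletons among the marked vertices)`. [this work] -/
theorem Pr2W_nonHub_le_mul {p : Sym2 V → ℝ} (hp0 : ∀ e, 0 ≤ p e) (hp1 : ∀ e, p e ≤ 1) (a b c y : V) :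
    Pr2W D p (nonHubEvent D a b c y) ≤ PrW D p (targetFst D a b c y) * PrW D p (targetSnd D a b c y) := by
  rw [← Pr2W_targetEvent_eq_mul]
  exact Pr2W_nonHub_le hp0 hp1 a b c y

end Summit.CriticalPhenomena.PercolationContinuityZ3.Theorems.W0NonHubSwap

end
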